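import Summits.ResolutionOfSingularities.ResolutionOfSingularities.Theorems.HomologicalConductorNoZenoRKernelNormalForm
import Summits.ResolutionOfSingularities.ResolutionOfSingularities.Theorems.HomologicalConductorStrictDropRegroundGeneral
import Summits.ResolutionOfSingularities.ResolutionOfSingularities.Theorems.HomologicalConductorStrictDropTowerDimAntitone
import Summits.ResolutionOfSingularities.ResolutionOfSingularities.Theorems.HomologicalConductorNoZenoKernelLowDim
import HarnessLib

/-!
# Crux `NoZenoR` (stmt-ResolutionOfSingularities-19943): the SHARPEST FACT-FREE kernel door —
# `NoZenoR` ⟺ «under `StrictDrop`, no TOP-DIMENSIONAL, NORMAL, MAXIMALLY DOMINATED kernel datum of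
# transcendence degree ≥ 2»

Route `ResolutionOfSingularities/HomologicalConductor` (cell decomp-res, hand leafhand-res-homologicalconduct-14 g0).
OURS: AI-written bookkeeping over tree theorems, weaker than expert review; nothing here is a statement of the
manuscript under review (Hironaka 2017).  SUPPORT level, counted 0.  Def-free, fact-free, no new named facts.

The tree's door `DiscreteDominator.noZenoR_iff_noKernelDatum` (fact-free) says: `NoZenoR` ⟺ under `StrictDrop` no
admissible datum `(p, k, K, O, A)` has a canonical normalised `ca`-tower all of whose weak dominators are non-noetherian.
Three normalisations of such a kernel datum are FREE (each is a tree theorem; none needs a published surface fact):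

* RE-GROUNDING (hand 3, `Reground.exists_reground` + `exists_ringKrullDim_tower_eventually_eq`): the stage dimension is
  eventually constant `= e`; over the lifted purely transcendental base field `F ⊆ O` the terminal run IS the canonical
  tower of a finitely generated `F`-datum `A'` of Krull dimension `e`, all of whose stages have dimension `e`
  (TOP-DIMENSIONAL: every centre of `O` is a closed point) — `dominates_iff_of_toSubring_eq` carries the kernel binders;
* MAXIMALITY (`stub_maxDominator`, `CompositeDominator.tower_eq_of_dominates`): `O` may be replaced by a MAXIMAL weak
  dominator without changing the tower;
* NORMALITY (`NoZenoR.KernelNormalForm.exists_normal_kernelDatum_of_kernelDatum`, this hand): re-base at the finitely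
  generated integrally closed model of `T_1`;
and the transcendence degree of a kernel datum is `≥ 2` (`isNoetherianRing_valuationSubring_of_trdeg_le_one`: in
`tr.deg ≤ 1` the valuation ring itself is a noetherian weak dominator).

* **`noZenoR_iff_noTopNormalMaxKernelDatum`** — `NoZenoR` ⟺ «given `StrictDrop`, there is NO admissible datum
  `(p, k, K, O, A)` with `¬ tr.deg_k K ≤ 1`, `A` integrally closed (in itself and in `K`), EVERY stage of Krull dimension
  `dim A` (top-dimensional tower), every weak dominator non-noetherian, and `O` maximal among the weak dominators».

Compared with the tree: `…FourFacts.noZenoR_iff_maxKernel_of_facts4` has the same shape PLUS `¬ dim A ≤ 2`, at the price of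
the four surface prints (CJS 2020, Lipman (1.2), (4.1), (12.1)(ii)); the present door is print-free and adds normality.  So the
crux's ENTIRE fact-free content is the non-existence, under `StrictDrop`, of such a datum; the prints only dispose of `dim A = 2`.
No crux, kill test or summit statement is proved; resolution in char p is NOT proved.
-/

noncomputable section

-- single-problem summit: the doubled namespace component `ResolutionOfSingularities` is forced
set_option linter.dupNamespace false

namespace Summit.ResolutionOfSingularities.ResolutionOfSingularities.Theorems.NoZenoR.KernelNormalForm

open Summit.ResolutionOfSingularities.ResolutionOfSingularities.Theses.HomologicalConductor
open Summit.ResolutionOfSingularities.ResolutionOfSingularities.Theorems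
open Summit.ResolutionOfSingularities.ResolutionOfSingularities.Theorems.NoZeno
open Summit.ResolutionOfSingularities.ResolutionOfSingularities.Theorems.NoZeno.Birth
open Literature.AlgebraicGeometry.Resolution

variable {k K : Type} [Field k] [Field K] [Algebra k K]

/-! ## §1 Transport of the kernel binders along a re-grounding (towers equal as subrings, different base fields) -/

/-- Membership transport along an equality of underlying subrings of subalgebras over two base fields. [folklore] -/
theorem mem_iff_of_toSubring_eq {F : Type} [Field F] [Algebra F K] {S : Subalgebra k K} {S' : Subalgebra F K}
    (h : S.toSubring = S'.toSubring) (s : K) : s ∈ S ↔ s ∈ S' := by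
  have h' : s ∈ S.toSubring ↔ s ∈ S'.toSubring := by rw [h]
  exact h'

/-- **Weak domination is re-grounding invariant**: if the `A'`-tower (over `F`) is the shifted `A`-tower (over `k`) as
subrings of `K`, a valuation ring weakly dominates one iff it weakly dominates the other. [folklore] -/
theorem dominates_iff_of_toSubring_eq {F : Type} [Field F] [Algebra F K] (O : ValuationSubring K)
    (A : Subalgebra k K) (A' : Subalgebra F K) (m₀ : ℕ)
    (htw : ∀ n : ℕ, (tower O A (m₀ + n)).toSubring = (tower O A' n).toSubring) (U : ValuationSubring K) :
    (∀ n : ℕ, ∀ s ∈ tower O A' n, s ∈ U ∧ (s⁻¹ ∈ U → s⁻¹ ∈ O)) ↔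
      ∀ i : ℕ, ∀ s ∈ tower O A i, s ∈ U ∧ (s⁻¹ ∈ U → s⁻¹ ∈ O) := by
  constructor
  · intro h i s hs
    have hs' : s ∈ tower O A (m₀ + i) := d2rc_mem_tower_of_le O A (Nat.le_add_left i m₀) hs
    exact h i s ((mem_iff_of_toSubring_eq (htw i) s).mp hs')
  · intro h n s hs
    exact h (m₀ + n) s ((mem_iff_of_toSubring_eq (htw n) s).mpr hs)

/-- **The maximality binder is re-grounding invariant.** [folklore] -/
theorem maxDominator_iff_of_toSubring_eq {F : Type} [Field F] [Algebra F K] (O : ValuationSubring K)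
    (A : Subalgebra k K) (A' : Subalgebra F K) (m₀ : ℕ)
    (htw : ∀ n : ℕ, (tower O A (m₀ + n)).toSubring = (tower O A' n).toSubring) :
    (∀ O' : ValuationSubring K, O < O' → ∃ n : ℕ, ∃ s ∈ tower O A' n, s⁻¹ ∈ O' ∧ s⁻¹ ∉ O) ↔
      ∀ O' : ValuationSubring K, O < O' → ∃ i : ℕ, ∃ s ∈ tower O A i, s⁻¹ ∈ O' ∧ s⁻¹ ∉ O := by
  constructor
  · intro h O' hlt
    obtain ⟨n, s, hs, h₁, h₂⟩ := h O' hlt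
    exact ⟨m₀ + n, s, (mem_iff_of_toSubring_eq (htw n) s).mpr hs, h₁, h₂⟩
  · intro h O' hlt
    obtain ⟨i, s, hs, h₁, h₂⟩ := h O' hlt
    have hs' : s ∈ tower O A (m₀ + i) := d2rc_mem_tower_of_le O A (Nat.le_add_left i m₀) hs
    exact ⟨i, s, (mem_iff_of_toSubring_eq (htw i) s).mp hs', h₁, h₂⟩

/-! ## §2 Transcendence degree of a kernel datum -/

/-- **A kernel datum has transcendence degree `≥ 2`** (fact-free): in `tr.deg_k K ≤ 1` the valuation ring `O ∋ k` of the
finitely generated `K/k` is noetherian (tree `isNoetherianRing_valuationSubring_of_trdeg_le_one`, Zariski–Samuel VI §14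
Thm. 31) and dominates its own tower. [cite: ZariskiSamuel1960, Ch. VI §14, Thm. 31] -/
theorem not_trdeg_le_one_of_kernel (O : ValuationSubring K) (A : Subalgebra k K)
    (hk : ∀ c : k, algebraMap k K c ∈ O) (hA : A.FG) (hfr : IsFractionRing ↥A K)
    (hAO : A.toSubring ≤ O.toSubring)
    (hker : ∀ U : ValuationSubring K,
      (∀ i : ℕ, ∀ s ∈ tower O A i, s ∈ U ∧ (s⁻¹ ∈ U → s⁻¹ ∈ O)) → ¬ IsNoetherianRing ↥U) :
    ¬ Algebra.trdeg k K ≤ 1 := fun htr =>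
  hker O (fun m s hs => ⟨mem_valuationSubring_of_mem_tower O hk hAO m s hs, id⟩)
    (isNoetherianRing_valuationSubring_of_trdeg_le_one k K O A hk hA hfr htr)

/-! ## §3 The sharpest fact-free door -/

/-- **`NoZenoR` ⟺ «given `StrictDrop`, no TOP-DIMENSIONAL, NORMAL, MAXIMALLY DOMINATED kernel datum of transcendence
degree `≥ 2`»** (fact-free).  `→`: specialise `DiscreteDominator.noZenoR_iff_noKernelDatum`.  `←`: given a kernel datum
`(k, K, O, A)`: (1) re-ground at the start `m₀` of the terminal run of constant stage dimension `e`
(`exists_ringKrullDim_tower_eventually_eq`, `Reground.exists_reground`): an `F`-datum `A'`, `dim A' = e`, with the same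
(shifted) tower, hence the same weak dominators (`dominates_iff_of_toSubring_eq`) — a TOP-dimensional kernel datum;
(2) replace `O` by a maximal weak dominator `Om` (`stub_maxDominator`; same tower, `CompositeDominator.tower_eq_of_dominates`,
same dominators, `dominates_iff_of_dominates`); (3) re-base at the finitely generated integrally closed model `B` of `T_1`
(`exists_normal_kernelDatum_of_kernelDatum`): still top-dimensional (`dim B = tr.deg_F K = dim A' = e`,
`StagePresentation.ringKrullDim_eq_of_trdeg_eq`), kernel, maximal; (4) `tr.deg_F K ≥ 2` by `not_trdeg_le_one_of_kernel`.
The excluded datum `(F, K, Om, B)` then contradicts the hypothesis. [this work; composition of tree results]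
[cite: ZariskiSamuel1960, Ch. VI §5, §14] [cite: Matsumura1987, Thm. 5.6] -/
theorem noZenoR_iff_noTopNormalMaxKernelDatum : NoZenoR ↔ (StrictDrop → ∀ p : ℕ, p.Prime →
    ∀ (k K : Type) [Field k] [CharP k p] [Field K] [Algebra k K] (O : ValuationSubring K)
      (A : Subalgebra k K), (∀ c : k, algebraMap k K c ∈ O) → A.FG → IsFractionRing ↥A K →
      A.toSubring ≤ O.toSubring → ¬ Algebra.trdeg k K ≤ 1 →
      IsIntegrallyClosed ↥A → (∀ x : K, IsIntegral ↥A x → x ∈ A) →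
      (∀ n : ℕ, ringKrullDim ↥(tower O A n) = ringKrullDim ↥A) →
      (∀ O' : ValuationSubring K,
        (∀ m : ℕ, ∀ s ∈ tower O A m, s ∈ O' ∧ (s⁻¹ ∈ O' → s⁻¹ ∈ O)) → ¬ IsNoetherianRing ↥O') →
      (∀ O' : ValuationSubring K, O < O' → ∃ m : ℕ, ∃ s ∈ tower O A m, s⁻¹ ∈ O' ∧ s⁻¹ ∉ O) →
      False) := by
  rw [DiscreteDominator.noZenoR_iff_noKernelDatum]
  constructor
  · intro h hD p hp k K _ _ _ _ O A hk hA hfr hAO _ _ _ _ hker _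
    exact h hD p hp k K O A hk hA hfr hAO hker
  · intro h hD p hp k K _ _ _ _ O A hk hA hfr hAO hker
    haveI := hfr
    -- (1) re-ground at the start of the terminal run of constant stage dimension `e`
    obtain ⟨m₀, e, -, he⟩ := exists_ringKrullDim_tower_eventually_eq O A hA hfr hAO
    obtain ⟨F, A', hkF, hA'fg, hA'fr, hA'O, hdimA', htw⟩ :=
      Reground.exists_reground O A hk hA hfr hAO m₀ (h := e) (he m₀ le_rfl)
    haveI : CharP ↥F p := (Algebra.charP_iff k ↥F p).mp inferInstance
    have htw₁ : ∀ n : ℕ, (tower O A (m₀ + n)).toSubring = (tower O A' n).toSubring := fun n => (htw n).1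
    have htop' : ∀ n : ℕ, ringKrullDim ↥(tower O A' n) = (e : WithBot ℕ∞) := by
      intro n
      have h1 : ringKrullDim ↥(tower O A (m₀ + n)) = ringKrullDim ↥(tower O A' n) :=
        ringKrullDim_eq_of_ringEquiv (RingEquiv.subringCongr (htw n).1)
      rw [← h1, he (m₀ + n) (Nat.le_add_right m₀ n)]
    have hker' : ∀ U : ValuationSubring K,
        (∀ n : ℕ, ∀ s ∈ tower O A' n, s ∈ U ∧ (s⁻¹ ∈ U → s⁻¹ ∈ O)) → ¬ IsNoetherianRing ↥U :=
      fun U hU => hker U ((dominates_iff_of_toSubring_eq O A A' m₀ htw₁ U).mp hU)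
    -- (2) a maximal weak dominator `Om ≥ O` of the `A'`-tower
    obtain ⟨Om, -, hdom, hmax⟩ := stub_maxDominator (↥F) K O A' hkF hA'O
    have hT : ∀ m : ℕ, tower Om A' m = tower O A' m :=
      CompositeDominator.tower_eq_of_dominates O A' Om hkF hA'fg hA'fr hA'O hdom
    have hkOm : ∀ c : ↥F, algebraMap (↥F) K c ∈ Om := CompositeDominator.algebraMap_mem_of_dominates O A' Om hdom
    have hA'Om : A'.toSubring ≤ Om.toSubring := CompositeDominator.le_of_dominates O A' Om hdom
    have hkerOm : ∀ U : ValuationSubring K,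
        (∀ m : ℕ, ∀ s ∈ tower Om A' m, s ∈ U ∧ (s⁻¹ ∈ U → s⁻¹ ∈ Om)) → ¬ IsNoetherianRing ↥U :=
      fun U hU => hker' U ((CompositeDominator.dominates_iff_of_dominates O A' Om hkF hA'fg hA'fr hA'O hdom U).mp hU)
    have hmaxOm : ∀ O' : ValuationSubring K, Om < O' → ∃ m : ℕ, ∃ s ∈ tower Om A' m, s⁻¹ ∈ O' ∧ s⁻¹ ∉ Om := by
      intro O' hlt
      obtain ⟨m, s, hs, hinv, hninv⟩ := hmax O' hlt
      rw [← hT m] at hs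
      exact ⟨m, s, hs, hinv, hninv⟩
    -- (3) re-base `(Om, A')` at the finitely generated integrally closed model `B` of `T_1`
    obtain ⟨B, hBfg, hA'B, hBOm, hBfr, hBic, hBint, hBtower, hkerB, hmaxB⟩ :=
      exists_normal_kernelDatum_of_kernelDatum Om A' hkOm hA'fg hA'fr hA'Om hkerOm
    -- top-dimensionality of the `B`-tower: `dim (tower Om B j) = dim T'_(1+j) = e = dim B`
    haveI : Algebra.FiniteType (↥F) ↥A' := A'.fg_iff_finiteType.mp hA'fg
    haveI : IsFractionRing ↥A' K := hA'fr
    obtain ⟨N, hN, hNtr⟩ := exists_ringKrullDim_eq_and_trdeg_eq (↥F) ↥A'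
    have hNe : N = e := by
      have h1 := hN.symm.trans hdimA'
      exact_mod_cast h1
    have htrF : Algebra.trdeg (↥F) K = e := by
      rw [trdeg_eq_trdeg_of_isFractionRing A', hNtr, hNe]
    have hdimB : ringKrullDim ↥B = (e : WithBot ℕ∞) :=
      StagePresentation.ringKrullDim_eq_of_trdeg_eq A' B hA'fr hA'B hBfg htrF
    have htopB : ∀ j : ℕ, ringKrullDim ↥(tower Om B j) = ringKrullDim ↥B := by
      intro j
      rw [hBtower j, hT (1 + j), htop' (1 + j), hdimB]
    -- (4) transcendence degree `≥ 2`
    have htr2 : ¬ Algebra.trdeg (↥F) K ≤ 1 := not_trdeg_le_one_of_kernel Om B hkOm hBfg hBfr hBOm hkerB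
    exact h hD p hp (↥F) K Om B hkOm hBfg hBfr hBOm htr2 hBic hBint htopB hkerB (hmaxB hmaxOm)

end Summit.ResolutionOfSingularities.ResolutionOfSingularities.Theorems.NoZenoR.KernelNormalForm

end
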